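import Summits.BirchSwinnertonDyer.BirchSwinnertonDyer.Theorems.ThetaPartnerAtTwoSignedKatoUpToAtTwoCuspFactorOddCharacters
import Summits.BirchSwinnertonDyer.BirchSwinnertonDyer.Theorems.ByReductionTypeAtTwoSupersingularSharpTwo
import HarnessLib

/-!
# Route `ThetaPartnerAtTwo` (TP2), crux K3 `SignedKatoDivisibilityUpToAtTwo` (stmt-BirchSwinnertonDyer-20308 / K3P′ 25631), line
# `colemanrat` v13, assembly brick B4a — HECKE BASE CASES AT `2`: the twisted symbol sums of the TRIVIAL character at the
# two bottom levels `4 = 2^{0+e₀}` and `8 = 2^{1+e₀}`, and «even imprimitive ⟹ trivial» there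

Width seat `bsd-wall-tp2-p2x-w3` g7 (cell `bsd-wall`), brick B4(a) of the lead's memo
`Cruxes/SignedKatoDivisibilityUpToAtTwo/G7-ASSEMBLY-v1.md` (§0 step 6, §2 row B4). HONEST FRAMING: theorems only (no definition,
no named fact, no instance, no `sorry`); pure modular-symbol / character algebra for ONE rational newform; closes no item;
K3 / K3P′ are NOT settled and BSD is NOT proved by any of this.

## What

The character-value socket CORE_χ^prim (`CoreChi.coreChi_of_coreChiPrim`, `…CoreOfPrimitiveCharValues`) asks the (ERL_χ) identity
`ν(χ(γ)−1)·P_n(χ) = μ(χ(γ)−1)·ratTwistedSymbolSum f χ` for `χ : DirichletCharacter ℂ₂ (2^{n+e₀})` (`e₀ = cyclotomicExponent 2 = 2`)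
even of `2`-power order with `χ` PRIMITIVE or `n ≤ 1`. The imprimitive cases are exactly the trivial character at the levels `4`
and `8` (§1), where the right-hand side is a HECKE sum at the good prime `2` (Mazur–Tate–Teitelbaum (4.2),
`a₂[r]⁺ = [r/2]⁺ + [(r+1)/2]⁺ + [2r]⁺`):

* §1 `eq_one_of_even_four`, `eq_one_of_even_of_not_isPrimitive_eight`, and in the socket's currency
  `eq_one_of_even_of_not_isPrimitive_of_le_one`: an EVEN Dirichlet character modulo `2^{n+e₀}`, `n ≤ 1`, which is not primitive
  (automatic at `n = 0`) is TRIVIAL (`(ℤ/8)^× = ⟨−1, 5⟩`, and imprimitive mod `8` means `χ(5) = 1`, tree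
  `OddTwistSupply.isPrimitive_of_apply_ne_one`).
* §2 `ratTwistedSymbolSum_one_eq_ratCast`: for the trivial character mod `m` with values in any field of characteristic `0`,
  `ratTwistedSymbolSum f 1 = ∑_{u ∈ (ℤ/m)^×} [u/m]⁺_f` (cast from `ℚ`).
* §3 For a normalised newform `f` of ODD level with rational coefficients and `a₂(f) = a`:
  `ratTwistedSymbolSum f (1 mod 4) = (a² − 2a − 1)·[0]⁺_f` and `ratTwistedSymbolSum f (1 mod 8) = (a³ − 2a² − 3a + 4)·[0]⁺_f`
  (the tree's unit sums `sum_units_ratPlusSymbol_level_two_eq` / `…_level_three_eq` at `p = 2`); at `a₂ = 0` (the habitat: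
  good supersingular at `2` with `a₂ = 0`) these are **`−[0]⁺_f`** and **`4·[0]⁺_f`** — memo §0.6:
  `RTSS(1 mod 4) = [1/4]⁺ + [3/4]⁺ = −[0]⁺`, `RTSS(1 mod 8) = 4[0]⁺`.
* §4 The same values stated on the socket's binders (`χ` even, not primitive, level `2^{n+e₀}`, `n = 0, 1`), and the evaluation
  `∑' k, F k·(χ(γ) − 1)^k = F 0` of a power series at the trivial character (`χ(γ) − 1 = 0`).

References: B. Mazur, J. Tate, J. Teitelbaum, Invent. Math. 84 (1986) §I.4 (4.2), §I.8 (8.6) [MazurTateTeitelbaum1986Invent];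
L. Washington, *Introduction to cyclotomic fields* (1997) §7.2 (`(ℤ/2^e)^× = ±⟨5⟩`) [Washington1997].
-/

set_option autoImplicit false
-- the Theorems namespace of this sub repeats the summit name by design (D-0017 nested layout)
set_option linter.dupNamespace false

noncomputable section

open scoped MatrixGroups ModularForm

open CongruenceSubgroup Literature.NumberTheory.EllipticCurves Literature.NumberTheory.EllipticCurves.ModularForms

namespace Summit.BirchSwinnertonDyer.BirchSwinnertonDyer.Theorems.SignedKatoOffTwo.HeckeBase

/-! ## §1 Even imprimitive characters at the levels `4` and `8` are trivial -/

section Characters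

variable {R : Type*} [Field R]

/-- **An even Dirichlet character modulo `4` is trivial**: `(ℤ/4)^× = {±1}` and `χ(−1) = 1`. [cite: Washington1997, §7.2] -/
theorem eq_one_of_even_four (χ : DirichletCharacter R 4) (hev : χ.Even) : χ = 1 := by
  refine MulChar.ext fun u ↦ ?_
  rw [MulChar.one_apply_coe]
  have key : ∀ a : ZMod 4, (∃ b, a * b = 1) → a = 1 ∨ a = -1 := by decide
  rcases key (u : ZMod 4) ⟨((u⁻¹ : (ZMod 4)ˣ) : ZMod 4), u.mul_inv⟩ with h | h
  · rw [h, map_one]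
  · rw [h]; exact hev

/-- **An imprimitive Dirichlet character modulo `8` is `1` at `5`**: otherwise `χ(5^{2^0}) ≠ 1` makes it primitive
(tree `OddTwistSupply.isPrimitive_of_apply_ne_one` at `e = 3`). [cite: Washington1997, §7.2] -/
theorem apply_five_eq_one_of_not_isPrimitive_eight (χ : DirichletCharacter R 8) (hnp : ¬ χ.IsPrimitive) : χ 5 = 1 := by
  by_contra h5
  refine hnp (OddTwistSupply.isPrimitive_of_apply_ne_one R (e := 3) le_rfl χ ?_)
  have h : ((5 ^ 2 ^ (3 - 3) : ℕ) : ZMod (2 ^ 3)) = (5 : ZMod 8) := by decide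
  rw [h]
  exact h5

/-- An even Dirichlet character modulo `8` with `χ(5) = 1` is trivial: `(ℤ/8)^× = {1, 5, −1, −5}`. [cite: Washington1997, §7.2] -/
theorem eq_one_of_even_of_apply_five_eq_one_eight (χ : DirichletCharacter R 8) (hev : χ.Even) (h5 : χ 5 = 1) : χ = 1 := by
  refine MulChar.ext fun u ↦ ?_
  rw [MulChar.one_apply_coe]
  have key : ∀ a : ZMod 8, (∃ b, a * b = 1) → a = 1 ∨ a = 5 ∨ a = -1 ∨ a = -1 * 5 := by decide
  rcases key (u : ZMod 8) ⟨((u⁻¹ : (ZMod 8)ˣ) : ZMod 8), u.mul_inv⟩ with h | h | h | h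
  · rw [h, map_one]
  · rw [h, h5]
  · rw [h]; exact hev
  · rw [h, map_mul, h5, mul_one]; exact hev

/-- **An even imprimitive Dirichlet character modulo `8` is trivial.** [cite: Washington1997, §7.2] -/
theorem eq_one_of_even_of_not_isPrimitive_eight (χ : DirichletCharacter R 8) (hev : χ.Even) (hnp : ¬ χ.IsPrimitive) :
    χ = 1 :=
  eq_one_of_even_of_apply_five_eq_one_eight χ hev (apply_five_eq_one_of_not_isPrimitive_eight χ hnp)

/-- **Socket currency.** An even, imprimitive Dirichlet character modulo `2^{n+e₀}` (`e₀ = cyclotomicExponent 2 = 2`) with `n ≤ 1`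
is the trivial character: these are exactly the non-primitive cases `n ≤ 1` of the hypothesis `χ.IsPrimitive ∨ n ≤ 1` of
CORE_χ^prim (`CoreChi.coreChi_of_coreChiPrim`). [cite: Washington1997, §7.2] -/
theorem eq_one_of_even_of_not_isPrimitive_of_le_one {n : ℕ} (hn : n ≤ 1)
    (χ : DirichletCharacter R (2 ^ (n + cyclotomicExponent 2))) (hev : χ.Even) (hnp : ¬ χ.IsPrimitive) : χ = 1 := by
  interval_cases n
  · exact eq_one_of_even_four χ hev
  · exact eq_one_of_even_of_not_isPrimitive_eight χ hev hnp

end Characters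

/-! ## §2 The twisted symbol sum of the trivial character is the unit sum of plus symbols -/

section Trivial

variable {N : ℕ} (f : CuspForm (Gamma0 N) 2) (R : Type*) [Field R] [CharZero R]

/-- **`∑_{a mod m} 𝟙(a)[a/m]⁺_f = ∑_{u ∈ (ℤ/m)^×} [u/m]⁺_f`** (cast `ℚ → R`): the trivial Dirichlet character is `1` on units and
`0` off them. [cite: MazurTateTeitelbaum1986Invent, §I.8 (8.6)] -/
theorem ratTwistedSymbolSum_one_eq_ratCast (m : ℕ) [NeZero m] :
    ratTwistedSymbolSum f (1 : DirichletCharacter R m) =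
      ((∑ u : (ZMod m)ˣ, ratPlusSymbol f ((((u : ZMod m)).val : ℚ) / m) : ℚ) : R) := by
  unfold ratTwistedSymbolSum
  rw [Rat.cast_sum, sum_units_eq_sum_filter_isUnit
    (F := fun b : ZMod m ↦ ((ratPlusSymbol f ((b.val : ℚ) / m) : ℚ) : R)), Finset.sum_filter]
  refine Finset.sum_congr rfl fun a _ ↦ ?_
  by_cases ha : IsUnit a
  · rw [MulChar.one_apply ha, one_mul, if_pos ha]
  · rw [MulChar.map_nonunit _ ha, zero_mul, if_neg ha]

end Trivial

/-! ## §3 Hecke at `2`: the trivial-character sums at the levels `4` and `8` -/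

section Hecke

variable {N : ℕ} [NeZero N] {f : CuspForm (Gamma0 N) 2} (R : Type*) [Field R] [CharZero R]

/-- **`∑_{a mod 4} 𝟙(a)[a/4]⁺_f = (a₂² − 2a₂ − 1)·[0]⁺_f`** for a normalised newform of odd level with rational coefficients and
`a₂(f) = a` (Hecke at `2`, Mazur–Tate–Teitelbaum (4.2): `[1/4]⁺ + [3/4]⁺ = a[1/2]⁺ − [0]⁺`, `[1/2]⁺ = (a − 2)[0]⁺`; the tree's
`sum_units_ratPlusSymbol_level_two_eq` at `p = 2`). Level written `2^L`, `L = 1 + 1`. [cite: MazurTateTeitelbaum1986Invent, §I.4 (4.2)] -/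
theorem ratTwistedSymbolSum_one_level_two_eq (hf : IsNewform0 f) (hQ : coeffField f = ⊥) (h2N : ¬ 2 ∣ N) {a : ℤ}
    (ha : cuspCoeff f 2 = a) (L : ℕ) (hL : L = 1 + 1) :
    ratTwistedSymbolSum f (1 : DirichletCharacter R (2 ^ L)) = ((((a : ℚ) ^ 2 - 2 * a - 1) * ratPlusSymbol f 0 : ℚ) : R) := by
  rw [ratTwistedSymbolSum_one_eq_ratCast]
  congr 1
  have h := Rank1Residual.Supersingular.sum_units_ratPlusSymbol_level_two_eq (p := 2) hf hQ h2N ha L hL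
  have e : ∀ u : (ZMod (2 ^ L))ˣ, ratPlusSymbol f ((((u : ZMod (2 ^ L))).val : ℚ) / ((2 ^ L : ℕ) : ℚ)) =
      ratPlusSymbol f ((((u : ZMod (2 ^ L))).val : ℚ) / ((2 : ℕ) : ℚ) ^ L) := fun u ↦ by rw [Nat.cast_pow]
  rw [Finset.sum_congr rfl fun u _ ↦ e u, h]
  push_cast
  ring

/-- **`∑_{a mod 8} 𝟙(a)[a/8]⁺_f = (a₂³ − 2a₂² − 3a₂ + 4)·[0]⁺_f`** for a normalised newform of odd level with rational coefficients and
`a₂(f) = a` (Hecke at `2` read at `1/4` and `3/4`; the tree's `sum_units_ratPlusSymbol_level_three_eq` at `p = 2`). Level `2^L`,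
`L = 2 + 1`. [cite: MazurTateTeitelbaum1986Invent, §I.4 (4.2)] -/
theorem ratTwistedSymbolSum_one_level_three_eq (hf : IsNewform0 f) (hQ : coeffField f = ⊥) (h2N : ¬ 2 ∣ N) {a : ℤ}
    (ha : cuspCoeff f 2 = a) (L : ℕ) (hL : L = 2 + 1) :
    ratTwistedSymbolSum f (1 : DirichletCharacter R (2 ^ L)) =
      ((((a : ℚ) ^ 3 - 2 * a ^ 2 - 3 * a + 4) * ratPlusSymbol f 0 : ℚ) : R) := by
  rw [ratTwistedSymbolSum_one_eq_ratCast]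
  congr 1
  have h := Theorems.sum_units_ratPlusSymbol_level_three_eq (p := 2) hf hQ h2N ha L hL
  have e : ∀ u : (ZMod (2 ^ L))ˣ, ratPlusSymbol f ((((u : ZMod (2 ^ L))).val : ℚ) / ((2 ^ L : ℕ) : ℚ)) =
      ratPlusSymbol f ((((u : ZMod (2 ^ L))).val : ℚ) / ((2 : ℕ) : ℚ) ^ L) := fun u ↦ by rw [Nat.cast_pow]
  rw [Finset.sum_congr rfl fun u _ ↦ e u, h]
  push_cast
  ring

/-- **At `a₂ = 0`: `∑_{a mod 4} 𝟙(a)[a/4]⁺_f = −[0]⁺_f`** (memo §0.6: `RTSS(1 mod 4) = [1/4]⁺ + [3/4]⁺ = −[0]⁺`).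
[cite: MazurTateTeitelbaum1986Invent, §I.4 (4.2)] -/
theorem ratTwistedSymbolSum_one_level_two_eq_neg (hf : IsNewform0 f) (hQ : coeffField f = ⊥) (h2N : ¬ 2 ∣ N)
    (ha : cuspCoeff f 2 = 0) (L : ℕ) (hL : L = 1 + 1) :
    ratTwistedSymbolSum f (1 : DirichletCharacter R (2 ^ L)) = -((ratPlusSymbol f 0 : ℚ) : R) := by
  rw [ratTwistedSymbolSum_one_level_two_eq R hf hQ h2N (a := 0) (by rw [ha, Int.cast_zero]) L hL]
  push_cast
  ring

/-- **At `a₂ = 0`: `∑_{a mod 8} 𝟙(a)[a/8]⁺_f = 4·[0]⁺_f`** (memo §0.6: `RTSS(1 mod 8) = −2[1/2]⁺ = 4[0]⁺`).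
[cite: MazurTateTeitelbaum1986Invent, §I.4 (4.2)] -/
theorem ratTwistedSymbolSum_one_level_three_eq_four_mul (hf : IsNewform0 f) (hQ : coeffField f = ⊥) (h2N : ¬ 2 ∣ N)
    (ha : cuspCoeff f 2 = 0) (L : ℕ) (hL : L = 2 + 1) :
    ratTwistedSymbolSum f (1 : DirichletCharacter R (2 ^ L)) = 4 * ((ratPlusSymbol f 0 : ℚ) : R) := by
  rw [ratTwistedSymbolSum_one_level_three_eq R hf hQ h2N (a := 0) (by rw [ha, Int.cast_zero]) L hL]
  push_cast
  ring

end Hecke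

/-! ## §4 The base cases on the socket's binders (`χ` even, level `2^{n+e₀}`, `n = 0, 1`) -/

section Socket

variable {N : ℕ} [NeZero N] {f : CuspForm (Gamma0 N) 2} (R : Type*) [Field R] [CharZero R]

/-- **Base case `n = 0` (level `4 = 2^{0+e₀}`).** For a normalised newform of odd level with rational coefficients, `a₂(f) = a`, and
ANY even `χ` modulo `2^{0+e₀}` (necessarily trivial): `ratTwistedSymbolSum f χ = (a² − 2a − 1)·[0]⁺_f`.
[cite: MazurTateTeitelbaum1986Invent, §I.4 (4.2)] -/
theorem ratTwistedSymbolSum_eq_of_even_zero (hf : IsNewform0 f) (hQ : coeffField f = ⊥) (h2N : ¬ 2 ∣ N) {a : ℤ}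
    (ha : cuspCoeff f 2 = a) (χ : DirichletCharacter R (2 ^ (0 + cyclotomicExponent 2))) (hev : χ.Even) :
    ratTwistedSymbolSum f χ = ((((a : ℚ) ^ 2 - 2 * a - 1) * ratPlusSymbol f 0 : ℚ) : R) := by
  have h1 : χ = (1 : DirichletCharacter R (2 ^ (0 + cyclotomicExponent 2))) := eq_one_of_even_four χ hev
  rw [h1]
  exact ratTwistedSymbolSum_one_level_two_eq R hf hQ h2N ha (0 + cyclotomicExponent 2) rfl

/-- **Base case `n = 1` (level `8 = 2^{1+e₀}`).** For a normalised newform of odd level with rational coefficients, `a₂(f) = a`, and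
any even NON-PRIMITIVE `χ` modulo `2^{1+e₀}` (necessarily trivial): `ratTwistedSymbolSum f χ = (a³ − 2a² − 3a + 4)·[0]⁺_f`.
[cite: MazurTateTeitelbaum1986Invent, §I.4 (4.2)] -/
theorem ratTwistedSymbolSum_eq_of_even_of_not_isPrimitive_one (hf : IsNewform0 f) (hQ : coeffField f = ⊥) (h2N : ¬ 2 ∣ N)
    {a : ℤ} (ha : cuspCoeff f 2 = a) (χ : DirichletCharacter R (2 ^ (1 + cyclotomicExponent 2))) (hev : χ.Even)
    (hnp : ¬ χ.IsPrimitive) :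
    ratTwistedSymbolSum f χ = ((((a : ℚ) ^ 3 - 2 * a ^ 2 - 3 * a + 4) * ratPlusSymbol f 0 : ℚ) : R) := by
  have h1 : χ = (1 : DirichletCharacter R (2 ^ (1 + cyclotomicExponent 2))) :=
    eq_one_of_even_of_not_isPrimitive_eight χ hev hnp
  rw [h1]
  exact ratTwistedSymbolSum_one_level_three_eq R hf hQ h2N ha (1 + cyclotomicExponent 2) rfl

/-- **Habitat base case `n = 0`, `a₂ = 0`: `ratTwistedSymbolSum f χ = −[0]⁺_f`** for every even `χ` modulo `2^{0+e₀}`.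
[cite: MazurTateTeitelbaum1986Invent, §I.4 (4.2)] -/
theorem ratTwistedSymbolSum_eq_neg_of_even_zero (hf : IsNewform0 f) (hQ : coeffField f = ⊥) (h2N : ¬ 2 ∣ N)
    (ha : cuspCoeff f 2 = 0) (χ : DirichletCharacter R (2 ^ (0 + cyclotomicExponent 2))) (hev : χ.Even) :
    ratTwistedSymbolSum f χ = -((ratPlusSymbol f 0 : ℚ) : R) := by
  rw [ratTwistedSymbolSum_eq_of_even_zero R hf hQ h2N (a := 0) (by rw [ha, Int.cast_zero]) χ hev]
  push_cast
  ring

/-- **Habitat base case `n = 1`, `a₂ = 0`: `ratTwistedSymbolSum f χ = 4·[0]⁺_f`** for every even non-primitive `χ` modulo `2^{1+e₀}`.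
[cite: MazurTateTeitelbaum1986Invent, §I.4 (4.2)] -/
theorem ratTwistedSymbolSum_eq_four_mul_of_even_of_not_isPrimitive_one (hf : IsNewform0 f) (hQ : coeffField f = ⊥)
    (h2N : ¬ 2 ∣ N) (ha : cuspCoeff f 2 = 0) (χ : DirichletCharacter R (2 ^ (1 + cyclotomicExponent 2))) (hev : χ.Even)
    (hnp : ¬ χ.IsPrimitive) :
    ratTwistedSymbolSum f χ = 4 * ((ratPlusSymbol f 0 : ℚ) : R) := by
  rw [ratTwistedSymbolSum_eq_of_even_of_not_isPrimitive_one R hf hQ h2N (a := 0) (by rw [ha, Int.cast_zero]) χ hev hnp]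
  push_cast
  ring

omit [CharZero R] in
/-- **The trivial character kills the variable**: `χ(γ) − 1 = 0` at `χ = 1` for the unit `γ = 5` of `ℤ/2^L`, so a power series
evaluated at `χ(γ) − 1` is its constant term: `∑' k, F k·(𝟙(γ) − 1)^k = F 0` (the shape of the (ERL_χ) identity of CORE_χ^prim at the
base cases). [folklore] -/
theorem tsum_mul_one_apply_sub_one_pow [TopologicalSpace R] (F : ℕ → R) (L : ℕ) :
    ∑' k, F k * ((1 : DirichletCharacter R (2 ^ L)) (cyclotomicGenerator 2 : ZMod (2 ^ L)) - 1) ^ k = F 0 := by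
  have hu : IsUnit ((cyclotomicGenerator 2 : ℕ) : ZMod (2 ^ L)) := by
    rw [ZMod.isUnit_iff_coprime]
    exact Nat.Coprime.pow_right L (by decide)
  rw [MulChar.one_apply hu, sub_self, tsum_eq_single 0 fun k hk ↦ by rw [zero_pow hk, mul_zero], pow_zero, mul_one]

end Socket

/-! ## §5 The base-case DISPATCHER for the quantifier of CORE_χ^prim

The (ERL_χ) clause of `CoreChi.coreChi_of_coreChiPrim` quantifies `∀ n χ, χ.Even → (∃ j, orderOf χ = 2^j) → (χ.IsPrimitive ∨ n ≤ 1) → Φ n χ`.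
By §1 the non-primitive instances are exactly `(n, χ) = (0, 𝟙 mod 4)` and `(1, 𝟙 mod 8)`, so it suffices to prove `Φ` at PRIMITIVE `χ`
(Kato's value law + Birch, bricks B2/B5) and at the two trivial characters (bricks B4a–B4c). -/

section Dispatch

variable {R : Type*} [Field R]

/-- The trivial Dirichlet character is even. [folklore] -/
theorem even_one (m : ℕ) : (1 : DirichletCharacter R m).Even := by
  show (1 : DirichletCharacter R m) (-1) = 1
  exact MulChar.one_apply isUnit_one.neg

/-- The trivial Dirichlet character has `2`-power order (`orderOf 1 = 1 = 2^0`). [folklore] -/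
theorem exists_orderOf_one_eq_two_pow (m : ℕ) : ∃ j : ℕ, orderOf (1 : DirichletCharacter R m) = 2 ^ j :=
  ⟨0, by rw [orderOf_one, pow_zero]⟩

/-- **Base-case dispatcher.** Let `Φ n χ` be any property of the pairs (`n`, `χ` a Dirichlet character modulo `2^{n+e₀}`), e.g. the
(ERL_χ) identity of CORE_χ^prim. If `Φ` holds for every even PRIMITIVE `χ` of `2`-power order and at the two trivial characters
`(0, 𝟙 mod 4)`, `(1, 𝟙 mod 8)`, then it holds for every even `χ` of `2`-power order with `χ.IsPrimitive ∨ n ≤ 1` — the exact quantifier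
of the hypothesis of `CoreChi.coreChi_of_coreChiPrim` (§1: even + imprimitive + `n ≤ 1` forces `χ = 1`).
[cite: Washington1997, §7.2] -/
theorem forall_of_isPrimitive_of_trivial
    (Φ : (n : ℕ) → DirichletCharacter R (2 ^ (n + cyclotomicExponent 2)) → Prop)
    (hprim : ∀ (n : ℕ) (χ : DirichletCharacter R (2 ^ (n + cyclotomicExponent 2))),
      χ.Even → (∃ j : ℕ, orderOf χ = 2 ^ j) → χ.IsPrimitive → Φ n χ)
    (h0 : Φ 0 1) (h1 : Φ 1 1) :
    ∀ (n : ℕ) (χ : DirichletCharacter R (2 ^ (n + cyclotomicExponent 2))),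
      χ.Even → (∃ j : ℕ, orderOf χ = 2 ^ j) → (χ.IsPrimitive ∨ n ≤ 1) → Φ n χ := by
  intro n χ hev hord hbase
  by_cases hp : χ.IsPrimitive
  · exact hprim n χ hev hord hp
  have hn : n ≤ 1 := hbase.resolve_left hp
  have hχ : χ = 1 := eq_one_of_even_of_not_isPrimitive_of_le_one hn χ hev hp
  subst hχ
  interval_cases n
  · exact h0
  · exact h1

/-- **Dispatcher, primitive-only form.** If `Φ` holds for every even primitive `χ` of `2`-power order at EVERY level (no base cases
singled out) and at the two trivial characters, then the CORE_χ^prim quantifier holds. (Same as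
`forall_of_isPrimitive_of_trivial`; recorded with the trivial cases last for `refine`.) [cite: Washington1997, §7.2] -/
theorem forall_of_isPrimitive_of_trivial'
    {Φ : (n : ℕ) → DirichletCharacter R (2 ^ (n + cyclotomicExponent 2)) → Prop}
    (hprim : ∀ (n : ℕ) (χ : DirichletCharacter R (2 ^ (n + cyclotomicExponent 2))),
      χ.Even → (∃ j : ℕ, orderOf χ = 2 ^ j) → χ.IsPrimitive → Φ n χ)
    (n : ℕ) (χ : DirichletCharacter R (2 ^ (n + cyclotomicExponent 2))) (hev : χ.Even)
    (hord : ∃ j : ℕ, orderOf χ = 2 ^ j) (hbase : χ.IsPrimitive ∨ n ≤ 1) (h0 : Φ 0 1) (h1 : Φ 1 1) : Φ n χ :=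
  forall_of_isPrimitive_of_trivial Φ hprim h0 h1 n χ hev hord hbase

end Dispatch

end Summit.BirchSwinnertonDyer.BirchSwinnertonDyer.Theorems.SignedKatoOffTwo.HeckeBase

end
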